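import Literature.NumberTheory.EllipticCurves.YanZhu2026.CyclotomicProductDivisibilityProofs
import Literature.NumberTheory.EllipticCurves.YanZhu2026.TwistGoodOrdinaryProofs
import Summits.BirchSwinnertonDyer.Rank1Residual.X10.ClassX10bLeaf
import Summits.BirchSwinnertonDyer.Rank1Residual.X10.UnitRoadProp38
import Summits.BirchSwinnertonDyer.Rank1Residual.GreenbergMuConjecture
import Literature.NumberTheory.EllipticCurves.KatoRankBoundProofs
import HarnessLib

/-!
# Class X10b (`p = 3`, good ordinary, `E[3]` irreducible, `ρ̄_{E,3}` NOT surjective), print road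
# «Yan–Zhu 2026 under irreducibility only»: Greenberg's `μ = 0` + the two-variable DATA of §4.1 ⟹
# `MazurMainConjectureOnClassX10b` ⟹ the leaf `BSDpOnClassX10b` — NO analytic certificate, NO Kato package

Cell `pub/bsd-print-x9` (D-0131 (2) print tier; leaves `ClassX9` + `ClassX10b`), seat
`bsd-print-x9-p1`; the `p = 3` twin of `PrintX9GreenbergMuBridge.lean` (class X9, `p ≥ 5`,
Burungale–Castella–Skinner's four-fold display (5.3)). Here the printed integral input is the TWO-fold
product display of the journal proof of Yan–Zhu's cyclotomic theorem (v2 Thm. 4.9 = v4 Thm. 5.2), in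
the tree a THEOREM parametric in the two-variable data of Yan–Zhu §4.1
(`YanZhu2026.prod_charIdeal_le_span_of_facts`: Lemma 5.3 + Prop. 3.7 + Thm. 4.2 (1)), and the
per-pair kernel is `YanZhu2026.charIdeal_eq_padicLFunction_of_mu_eq_zero_of_facts` (+ the rational
clause of Thm. 4.9 at `E` and at `E^K`, Greenberg–Vatsal Prop. 3.7, `μ = 0` at `E` and at `E^K` ⟹
`Char X(E/ℚ_∞) = (L_3(f_E, α))` in `Λ`). THEOREMS ONLY; nothing booked; labels unchanged.

What is an explicit HYPOTHESIS here and why (numbers, not adjectives): `hData` — at an X10b pair and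
a cyclotomic datum `(κ, γ)` over `ℚ`, the EXISTENCE of the two-variable data of Yan–Zhu §4.1 / proof
of Thm. 5.2: a `p`-adic embedding `ι : ℤ̄ → ℂ_3`, an imaginary quadratic `K` with `3` split, every
`ℓ ∣ N_E` split (Heegner), `(N_E, d_K) = 1`, `E[3]` irreducible and `ρ̄_{E,3}|_{G_K}` absolutely
irreducible, and a cyclotomic/anticyclotomic generator pair `(κ₁, κ₂; γ₁, γ₂)` of `K` with `γ₁|_{ℚ̄}` a
generator of `κ` matching the cyclotomic variable. In print this is "Choose an imaginary quadratic
field `K` such that all primes dividing `pN` split in `K` and `ρ̄_E|_{G_K}` remains absolutely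
irreducible" (v4 l.1142–1143) plus notation; in the tree the arithmetic half of the choice of `K` is
PROVED (`exists_auxiliaryImaginaryQuadraticDiscr`), the Galois half is the fact
`MatarNekovar2019.prop526_…`, and the generator pair has NO existence theorem
(`ZpExtension.IsTopGeneratorPair`) — so `hData` is a TYPING gap (data, no new mathematics), carried
verbatim; it is the only hypothesis of this file beyond named facts and Greenberg's conjecture.

* §1 `mazurMainConjecture_three_of_mu_eq_zero_of_twoVariableData` — per pair: `μ = 0` at `W` (all
  cyclotomic data) and at the twisted models `W^{(d)}` (`d ≠ 0`, `3 ∤ d`; torsion-guarded) + `hData`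
  + the named facts ⟹ `MazurMainConjecture W 3` (Néron normalisation, unit `ϖ`).
* §2 `mazurMainConjectureOnClassX10b_of_greenbergMuConjectureIrreducible_of_twoVariableData` —
  Greenberg's Conjecture 1.11 (irreducible form, typed leaf) + `hData` on the class + named facts ⟹
  X_A3 `MazurMainConjectureOnClassX10b`; `bsdpOnClassX10b_of_greenbergMuConjectureIrreducible_of_twoVariableData`
  — the leaf by `X10.bsdpOnClassX10b_of_mazurMainConjectureOnClassX10b` (+ its odd-prime published
  binders, + C3 on the rank-`1` pairs). Compared with `X10.bsdpOnClassX10b_of_katoMuTransferThree`: no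
  Kato package at `3`, no `AnalyticMuZeroOnClassX10b`; instead Greenberg (algebraic) + `hData`.

Honest status: CONDITIONAL (Greenberg OPEN; `hData` a typing gap; the Yan–Zhu facts carry the cell
flag `YZ26@3-BF-ERL-Ohta`); beyond-print theorem: no; the class label is unchanged. References:
[GreenbergLNM1716] Conj. 1.11, Thm. 4.1; [YanZhu2024MainConjNonCM] v2 Thm. 4.9 / v4 Thm. 5.2 and its
proof, Thm. 4.2, Lemma 5.3, Prop. 3.7, Thm. 4.15; [GreenbergVatsal2000] Prop. 3.7, Rem. 3.4;
[Miller2011LMS] Def. 1.1.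
-/

set_option linter.dupNamespace false

set_option autoImplicit false

noncomputable section

open scoped Classical MatrixGroups ModularForm

open CongruenceSubgroup WeierstrassCurve Field NumberField IsDedekindDomain
open Literature.NumberTheory.GaloisRepresentations
open Literature.NumberTheory.EllipticCurves Literature.NumberTheory.EllipticCurves.ModularForms
  Literature.NumberTheory.EllipticCurves.Rank1Residual
  Summit.BirchSwinnertonDyer.BirchSwinnertonDyer.Theorems.Rank1ResidualX1Defs
open Literature.NumberTheory.EllipticCurves.YanZhu2026

namespace Summit.BirchSwinnertonDyer.Rank1Residual.X10

/-! ### §1 Per pair: `μ = 0` at `E` and at its twists + the two-variable data ⟹ `MazurMainConjecture W 3` -/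

/-- **The per-pair step at an X10b-type pair, in Mazur's normalisation.** For `W` globally minimal,
good ordinary at `3` with `E[3]` irreducible, granted the named facts (Yan–Zhu Thm. 4.2 (1) `h42`, the
rational clause of the cyclotomic theorem `h49`, Lemma 5.3 `h53`, Prop. 3.7 `h37`, modularity `hmod`
/ `hmodP`, the period unit at `3` `h3`): if for every cyclotomic datum `(κ, γ)` over `ℚ` (i) the
two-variable data of Yan–Zhu §4.1 exist (`hData`, module docstring), (ii) `μ(X(W/ℚ_∞)) = 0` and
(iii) `μ = 0` (torsion-guarded) for the dual data of the twisted models `W^{(d)}`, `d ≠ 0`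
(`hμ`), then `MazurMainConjecture W 3`. Proof: `YanZhu2026.charIdeal_eq_padicLFunction_of_mu_eq_zero_of_facts`
at the data, with the twist `E^K` put on a globally minimal model (good ordinary at `3`:
`isOrdinaryAt_of_smul_eq_quadraticTwist_discr`, `3` split in `K`), then the unit `ϖ`.
[cite: YanZhu2024MainConjNonCM, Thm. 4.9 (v2) = Thm. 5.2 (v4) and its proof; Thm. 4.2 (1); Lemma 5.3; Prop. 3.7]
[cite: GreenbergVatsal2000, Prop. 3.7 and §3 Remark (3.4)] [cite: GreenbergLNM1716, §1 Conj. 1.11] -/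
theorem mazurMainConjecture_three_of_mu_eq_zero_of_twoVariableData
    (h42 : thm42_XOrd₂_isTorsion_charIdeal_le_perrinRiou)
    (h49 : thm49_charIdeal_eq_padicLFunction)
    (h53 : lemma53_charIdeal_mul_charIdeal_le_toPlus_charIdeal)
    (h37 : prop37_cycRestrict_perrinRiou_eq_padicLFunction_mul)
    (hmod : exists_isNewformOf) (hmodP : nonempty_modularParametrizationData)
    (h3 : realPeriodRat_eq_unit_mul_plusPeriod_three)
    (W : WeierstrassCurve ℚ) [W.IsElliptic] [W.IsGloballyMinimal] [Fact (Nat.Prime 3)]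
    (hgood : W.HasGoodReductionAtPrime 3) (hord : ¬ ((3 : ℕ) : ℤ) ∣ W.frobeniusTrace 3)
    (hirr : W.HasIrreducibleModPGaloisRep 3)
    (hData : ∀ (κ : ZpExtension ℚ 3) (γ : Field.absoluteGaloisGroup ℚ),
      κ.IsCyclotomic → κ.IsTopGenerator γ → IsCyclotomicVariable 3 γ →
      ∃ (_ι : integralClosure ℚ ℂ →+* ℂ_[3]) (K : Type) (_ : Field K) (_ : NumberField K)
        (κ₁ κ₂ : ZpExtension K 3) (γ₁ γ₂ : Field.absoluteGaloisGroup K)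
        (_ : ZpExtension.IsTopGeneratorPair κ₁ κ₂ γ₁ γ₂),
        IsImaginaryQuadratic K ∧ ((Ideal.span {(3 : ℤ)}).primesOver (𝓞 K)).ncard = 2 ∧
        SatisfiesHeegnerHypothesis (W.conductorNorm ℤ) K ∧
        IsCoprime (W.conductorNorm ℤ : ℤ) (NumberField.discr K) ∧
        (W.baseChange K).HasIrreducibleModPGaloisRep 3 ∧
        (∀ ρ : ModPGaloisRep K (ZMod 3) 2, (W.baseChange K).IsTorsionGaloisRep 3 ρ →
          FramedRep.IsAbsolutelyIrreducible ρ) ∧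
        κ₁.IsCyclotomic ∧ κ₂.IsAnticyclotomic ∧
        κ.IsTopGenerator (absGaloisRestrict ℚ K γ₁) ∧ IsCyclotomicVariable 3 (absGaloisRestrict ℚ K γ₁))
    (hμ : ∀ (κ : ZpExtension ℚ 3) (γ : Field.absoluteGaloisGroup ℚ),
      κ.IsCyclotomic → κ.IsTopGenerator γ → IsCyclotomicVariable 3 γ →
      (∀ D : W.SelmerDualData κ γ, D.mu = 0) ∧
      ∀ (d : ℚ), d ≠ 0 →
        ∀ D' : (W.quadraticTwist d).SelmerDualData κ γ, D'.IsTorsion → D'.mu = 0) :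
    MazurMainConjecture W 3 := by
  intro κ γ hκ hγ hγ' _ f hf ϖ hϖeq D
  obtain ⟨hμW, hμtw⟩ := hμ κ γ hκ hγ hγ'
  obtain ⟨ι, K, _instF, _instNF, κ₁, κ₂, γ₁, γ₂, hpair, hK, hsplit, hHeeg, hN, hirrK, habs, hκ₁, hκ₂,
    hγ₁, hγ₁'⟩ := hData κ γ hκ hγ hγ'
  haveI : Fact (ZpExtension.IsTopGeneratorPair κ₁ κ₂ γ₁ γ₂) := ⟨hpair⟩
  have hordW : GoodOrd W 3 := ⟨hgood, hord⟩
  -- the modular parametrisation at level `N_E`; its newform is `f`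
  obtain ⟨π⟩ := hmodP W
  have hfπ : f = π.f := hf.unique π.isNewformOf
  subst hfπ
  -- Thm. 4.2 (1): the type-I frame `F` and the divisibility (DIV)
  obtain ⟨F, hF, -, -, hdiv, -⟩ := h42 ι W K κ₁ κ₂ γ₁ γ₂ π le_rfl hordW hK hsplit hHeeg habs
  -- a globally minimal model of `E^K = E^{(d_K)}`: good ordinary at `3`, irreducible, its newform, `ϖ'`
  have hd : (NumberField.discr K : ℚ) ≠ 0 := by exact_mod_cast NumberField.discr_ne_zero K
  obtain ⟨W', hE', hM', C, hC⟩ := exists_isGloballyMinimal_smul_eq_quadraticTwist W hd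
  have hpd : ¬ ((3 : ℕ) : ℤ) ∣ NumberField.discr K :=
    not_dvd_discr_of_ncard_primesOver_eq_two hK.finrank_eq_two (Fact.out : Nat.Prime 3) hsplit
  have hord' : GoodOrd W' 3 :=
    isOrdinaryAt_of_smul_eq_quadraticTwist_discr hK.finrank_eq_two W W' hC 3 (by norm_num) hpd hordW
  have hirr' : Irr W' 3 := irr_of_smul_eq_quadraticTwist W W' hd hC hirr
  haveI : NeZero (W'.conductorNorm ℤ) := ⟨(W'.conductorNorm_pos_holds).ne'⟩
  obtain ⟨g, hg⟩ := hmod W'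
  obtain ⟨u', hu'1, hu'Ω⟩ := h3 W' hord'.1 hirr' g hg
  have hu'0 : (u' : ℝ) ≠ 0 := by
    have : (u' : ℚ_[3]) ≠ 0 := fun h0 => by rw [h0, norm_zero] at hu'1; exact zero_ne_one hu'1
    exact_mod_cast (show u' ≠ 0 from fun h0 => this (by rw [h0]; push_cast; rfl))
  have hϖ' : ((u'⁻¹ : ℚ) : ℝ) * W'.realPeriodRat = plusPeriod g := by
    rw [hu'Ω, Rat.cast_inv, ← mul_assoc, inv_mul_cancel₀ hu'0, one_mul]
  have hϖu' : ‖((u'⁻¹ : ℚ) : ℚ_[3])‖ = 1 := by rw [Rat.cast_inv, norm_inv, hu'1, inv_one]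
  have hϖu : ‖(ϖ : ℚ_[3])‖ = 1 := UnitRoad.norm_periodRatio_eq_one_three h3 W hgood hirr π.f π.isNewformOf ϖ hϖeq
  -- the dual datum of the twisted model and its `μ = 0` (torsion from the rational clause at `W'`)
  haveI := W.isElliptic_quadraticTwist hd
  set D' : (W.quadraticTwist (NumberField.discr K : ℚ)).SelmerDualData κ γ :=
    (W.quadraticTwist (NumberField.discr K : ℚ)).selmerDualData κ hγ with hD'
  obtain ⟨D'', hchar'', htors''⟩ :=
    Literature.NumberTheory.EllipticCurves.IsogenySelmerInfty.exists_selmerDualData_of_smul_eq 3 hC D'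
  have ht' : D'.IsTorsion :=
    htors''.mp (h49 W' 3 κ γ g le_rfl hord'.1 hord'.2 hirr' hκ hγ hγ' hg D'').1
  have hμD' : D'.mu = 0 := hμtw _ hd D' ht'
  -- the two-variable argument: `Char X(W/ℚ_∞) = (g₀)`, `ι g₀ = L_3(π.f, α)`
  obtain ⟨htors, g₀, hchar, hιg⟩ :=
    charIdeal_eq_padicLFunction_of_mu_eq_zero_of_facts h49 h53 h37 ι W K κ₁ κ₂ γ₁ γ₂ π κ γ D D' ϖ W'
      g u'⁻¹ rfl le_rfl hordW hirr hK hsplit hN hirrK hκ₁ hκ₂ hκ hγ hγ' hγ₁ hγ₁' hϖeq hϖu ⟨C, hC⟩ hg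
      hϖ' hϖu' hord' hF hdiv (hμW D) hμD'
  -- Mazur's normalisation: multiply by the unit `ϖ`
  set c : ℤ_[3] := ⟨(ϖ : ℚ_[3]), hϖu.le⟩ with hc_def
  have hcu : IsUnit c := PadicInt.isUnit_iff.mpr hϖu
  refine ⟨htors, PowerSeries.C c * g₀, ?_, ?_⟩
  · rw [hchar]
    exact (Ideal.span_singleton_mul_left_unit (hcu.map PowerSeries.C) g₀).symm
  · rw [map_mul, hιg, PowerSeries.map_C]
    rfl


/-! ### §2 Class level: Greenberg's conjecture + the two-variable data ⟹ X_A3 ⟹ the leaf -/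

/-- **Greenberg's Conjecture 1.11 (irreducible form, the typed leaf `GreenbergMuConjectureIrreducible`)
+ the two-variable data at every X10b pair (`hData`, module docstring) + the named facts ⟹ X_A3 =
`MazurMainConjectureOnClassX10b`** — no analytic certificate, no Kato package. At an X10b pair
(`ClassX10 W p`, so `p = 3`, good ordinary, `E[3]` irreducible; `¬ Surj W 3`) the conjecture is used at
`W` (torsion guard from the rational clause at a newform of `hmod`) and at the twisted models
`W^{(d)}` (`E^d[3] ≅ E[3] ⊗ χ_d` irreducible, `WeierstrassCurve.hasIrreducibleModPGaloisRep_quadraticTwist_iff`).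
CONDITIONAL; nothing booked. [cite: GreenbergLNM1716, §1 Conj. 1.11]
[cite: YanZhu2024MainConjNonCM, Thm. 4.9 (v2) = Thm. 5.2 (v4) and its proof] -/
theorem mazurMainConjectureOnClassX10b_of_greenbergMuConjectureIrreducible_of_twoVariableData
    (hGrμ : Summit.BirchSwinnertonDyer.Rank1Residual.GreenbergMuConjectureIrreducible)
    (h42 : thm42_XOrd₂_isTorsion_charIdeal_le_perrinRiou)
    (h49 : thm49_charIdeal_eq_padicLFunction)
    (h53 : lemma53_charIdeal_mul_charIdeal_le_toPlus_charIdeal)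
    (h37 : prop37_cycRestrict_perrinRiou_eq_padicLFunction_mul)
    (hmod : exists_isNewformOf) (hmodP : nonempty_modularParametrizationData)
    (h3 : realPeriodRat_eq_unit_mul_plusPeriod_three)
    (hData : ∀ (W : WeierstrassCurve ℚ) [W.IsElliptic] [W.IsGloballyMinimal] [Fact (Nat.Prime 3)],
      GoodOrd W 3 → Irr W 3 → ¬ Surj W 3 →
      ∀ (κ : ZpExtension ℚ 3) (γ : Field.absoluteGaloisGroup ℚ),
      κ.IsCyclotomic → κ.IsTopGenerator γ → IsCyclotomicVariable 3 γ →
      ∃ (_ι : integralClosure ℚ ℂ →+* ℂ_[3]) (K : Type) (_ : Field K) (_ : NumberField K)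
        (κ₁ κ₂ : ZpExtension K 3) (γ₁ γ₂ : Field.absoluteGaloisGroup K)
        (_ : ZpExtension.IsTopGeneratorPair κ₁ κ₂ γ₁ γ₂),
        IsImaginaryQuadratic K ∧ ((Ideal.span {(3 : ℤ)}).primesOver (𝓞 K)).ncard = 2 ∧
        SatisfiesHeegnerHypothesis (W.conductorNorm ℤ) K ∧
        IsCoprime (W.conductorNorm ℤ : ℤ) (NumberField.discr K) ∧
        (W.baseChange K).HasIrreducibleModPGaloisRep 3 ∧
        (∀ ρ : ModPGaloisRep K (ZMod 3) 2, (W.baseChange K).IsTorsionGaloisRep 3 ρ →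
          FramedRep.IsAbsolutelyIrreducible ρ) ∧
        κ₁.IsCyclotomic ∧ κ₂.IsAnticyclotomic ∧
        κ.IsTopGenerator (absGaloisRestrict ℚ K γ₁) ∧ IsCyclotomicVariable 3 (absGaloisRestrict ℚ K γ₁)) :
    MazurMainConjectureOnClassX10b := by
  intro W _ _ p _ hX hns
  obtain ⟨hp3, hgo, hirr, -⟩ := id hX
  subst hp3
  obtain ⟨hgood, hord⟩ := hgo
  refine mazurMainConjecture_three_of_mu_eq_zero_of_twoVariableData h42 h49 h53 h37 hmod hmodP h3 W
    hgood hord hirr (hData W ⟨hgood, hord⟩ hirr hns) ?_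
  intro κ γ hκ hγ hγ'
  haveI : NeZero (W.conductorNorm ℤ) := ⟨(W.conductorNorm_pos_holds).ne'⟩
  obtain ⟨f₀, hf₀⟩ := hmod W
  refine ⟨fun D => hGrμ W 3 κ γ hκ hγ hirr D
    (h49 W 3 κ γ f₀ le_rfl hgood hord hirr hκ hγ hγ' hf₀ D).1, ?_⟩
  intro d hd D' hD'
  haveI := W.isElliptic_quadraticTwist hd
  exact hGrμ (W.quadraticTwist d) 3 κ γ hκ hγ
    ((W.hasIrreducibleModPGaloisRep_quadraticTwist_iff hd 3).mpr hirr) D' hD'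

/-- **`BSDpOnClassX10b` from Greenberg's Conjecture 1.11 and the two-variable data** — both analytic
ranks, through the cell's kernel `bsdpOnClassX10b_of_mazurMainConjectureOnClassX10b` with its PUBLISHED
odd-prime binders (Perrin-Riou–Schneider `hS`, Perrin-Riou 1987 `hPR`, Mazur–Tate `σ` `hMT`, Greenberg
1999 Thm. 4.1 `hGr`, modularity `hmodP`/`hmod`, Gross–Zagier–Kolyvagin `hGZK`, the Yan–Zhu facts
`h42`/`h49`/`h53`/`h37`, the period unit at `3` `h3`) and the Schneider certificate C3 on the rank-`1`
pairs (`hC3`). Compared with `bsdpOnClassX10b_of_katoMuTransferThree`: no Kato package at `3`, no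
`AnalyticMuZeroOnClassX10b`; instead Greenberg (algebraic) and the data hypothesis `hData`.
CONDITIONAL (Greenberg OPEN; flag `YZ26@3-BF-ERL-Ohta`); nothing booked.
[cite: GreenbergLNM1716, §1 Conj. 1.11 and Thm. 4.1] [cite: Miller2011LMS, §1 and Def. 1.1]
[cite: YanZhu2024MainConjNonCM, Thm. 4.9 (v2) = Thm. 5.2 (v4) and its proof] -/
theorem bsdpOnClassX10b_of_greenbergMuConjectureIrreducible_of_twoVariableData
    (hGrμ : Summit.BirchSwinnertonDyer.Rank1Residual.GreenbergMuConjectureIrreducible)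
    (h42 : thm42_XOrd₂_isTorsion_charIdeal_le_perrinRiou)
    (h49 : thm49_charIdeal_eq_padicLFunction)
    (h53 : lemma53_charIdeal_mul_charIdeal_le_toPlus_charIdeal)
    (h37 : prop37_cycRestrict_perrinRiou_eq_padicLFunction_mul)
    (hmod : exists_isNewformOf) (hmodP : nonempty_modularParametrizationData)
    (h3 : realPeriodRat_eq_unit_mul_plusPeriod_three)
    (hS : Schneider1985_order_charGenerator_odd) (hPR : perrinRiou_rankOne_leadingTerms_odd)
    (hMT : mazur_tate_sigma_exists_odd) (hGr : greenberg_charValue_rankZero)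
    (hGZK : rank_eq_analyticRank_of_analyticRank_le_one)
    (hC3 : ∀ (W : WeierstrassCurve ℚ) [W.IsElliptic] [W.IsGloballyMinimal] (p : ℕ) [Fact p.Prime],
      ClassX10 W p → ¬ Surj W 3 → W.analyticRank = 1 →
        ∀ Dh : PAdicHeightData W p, Dh.IsCanonical → SchneiderConjecture Dh)
    (hData : ∀ (W : WeierstrassCurve ℚ) [W.IsElliptic] [W.IsGloballyMinimal] [Fact (Nat.Prime 3)],
      GoodOrd W 3 → Irr W 3 → ¬ Surj W 3 →
      ∀ (κ : ZpExtension ℚ 3) (γ : Field.absoluteGaloisGroup ℚ),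
      κ.IsCyclotomic → κ.IsTopGenerator γ → IsCyclotomicVariable 3 γ →
      ∃ (_ι : integralClosure ℚ ℂ →+* ℂ_[3]) (K : Type) (_ : Field K) (_ : NumberField K)
        (κ₁ κ₂ : ZpExtension K 3) (γ₁ γ₂ : Field.absoluteGaloisGroup K)
        (_ : ZpExtension.IsTopGeneratorPair κ₁ κ₂ γ₁ γ₂),
        IsImaginaryQuadratic K ∧ ((Ideal.span {(3 : ℤ)}).primesOver (𝓞 K)).ncard = 2 ∧
        SatisfiesHeegnerHypothesis (W.conductorNorm ℤ) K ∧
        IsCoprime (W.conductorNorm ℤ : ℤ) (NumberField.discr K) ∧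
        (W.baseChange K).HasIrreducibleModPGaloisRep 3 ∧
        (∀ ρ : ModPGaloisRep K (ZMod 3) 2, (W.baseChange K).IsTorsionGaloisRep 3 ρ →
          FramedRep.IsAbsolutelyIrreducible ρ) ∧
        κ₁.IsCyclotomic ∧ κ₂.IsAnticyclotomic ∧
        κ.IsTopGenerator (absGaloisRestrict ℚ K γ₁) ∧ IsCyclotomicVariable 3 (absGaloisRestrict ℚ K γ₁)) :
    BSDpOnClassX10b :=
  bsdpOnClassX10b_of_mazurMainConjectureOnClassX10b hS hPR hMT hGr hmodP hGZK hC3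
    (mazurMainConjectureOnClassX10b_of_greenbergMuConjectureIrreducible_of_twoVariableData hGrμ h42 h49
      h53 h37 hmod hmodP h3 hData)

end Summit.BirchSwinnertonDyer.Rank1Residual.X10

end
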